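import Literature.IUT.HodgeArakelov.BadPrimeGaussianMonoidsUnitsSaturationProofs
import Literature.IUT.HodgeArakelov.EtaleThetaDataOfSettingKummerTower
import Literature.IUT.HodgeArakelov.ThetaEvaluationModelEvTorsion
import Literature.IUT.HodgeArakelov.MonoThetaProjectiveThetaEnvProofs
import Mathlib.RingTheory.IntegralClosure.IsIntegral.Basic

/-!
# [IUTchII] Cor 3.5 (ii) / Cor 3.6 (ii) `∞`-level binders `hsat` (saturation of `M^×_TM`) and `hΘU` AT THE GENUINE RECORD
# over `Π = Π^tp_X̲̲` with constants `ℚ̄_pˣ ⊇ O` through `ε`: the model-data inputs `(c, hc)`, `hOtors`, `hOroot`, `hO`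
# (`Π`-stability), `hlim` DISCHARGED for print's `O = 𝒪^▷_{ℚ̄_p}` and for `O = 𝒪^×_{ℚ̄_p}` — proof companion

Proof-only companion (abc-iut cell, layer L6, seat abc-iut-w5-d192 gen 3; node **IUTchII:Cor3.6(ii)** «↷» at the `∞`-level,
sub-DAG `plan/L6/SUBDAG-IUTchII-Cor-36.md` row Cor-36.ii.r9, and the `∞`-level of NODES IUTchII:Cor3.5(ii)) to this seat's
`BadPrimeGaussianMonoidsUnitsSaturationProofs.lean` (p428301: `EtaleLevels.hsat_thetaEnvRecordKummer`,
`EtaleLevels.hThetaU_thetaEnvRecordKummer` — for abc-iut-w4-d019's GENUINE record `EtaleLevels.thetaEnvRecordKummer`, under the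
model-data inputs `hc : Function.Bijective c.hom` (the cyclotomic rigidity ISOMORPHISM), `hOtors` (`O ⊇ μ` with inverses),
`hOroot` (`O` root-closed in `A`), `hO` (`O` is `Π`-stable)), in the pattern of abc-iut-w4-d007's
`BadPrimeGaussianMonoidsGenuineRecordTorsionOfTower.lean` (the same discharge for `htors`): `(c, hc)` from
`exists_cyclotomeCoefficients_of_cyclotomeTower` (abc-iut-w4-d007, p422741) on abc-iut-w4-d043's chain tower
`EtaleLevels.cyclotomeTower mods hmods`, `hOtors` from abc-iut-w5-d205's `mem_unitGroup_padic_of_isOfFinOrder` (roots of unity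
are units of the ring of integers), `hlim` from abc-iut-w4-d030's `bijective_rigidLimHom`, and — NEW here — `hOroot` and `hO`
for the two printed constant monoids: `𝒪_{ℚ̄_p}` is INTEGRALLY CLOSED in `ℚ̄_p` (Mathlib `IsIntegral.of_pow` over abc-iut-L4's
`integersClosure = integralClosure 𝒪_{ℚ_p} ℚ̄_p`) and Galois-stable (abc-iut-L4 `smul_mem_nonzeroIntegers` /
`smul_mem_unitSubmonoid`). No definitions; nothing of those files is restated.

S. Mochizuki, *Inter-universal Teichmüller theory II*, kurims manuscript (Dec. 2020), Cor 3.5 (ii) p. 95 (bracket l. 3–7 on the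
writer's render paper:url-5036b4059555), Prop 3.1 (ii) p. 88, Cor 3.6 (ii) p. 100 [cite: Mochizuki2012, Cor 3.5 (ii) p.95];
[cite: MochizukiAbsTopIII2015, Definition 3.1 (i) p.66] (`𝒪^▷_{k̄} ⊇ 𝒪^×_{k̄} ⊇ μ(k̄)`, `𝒪_{k̄}` the ring of integers); classical
content: `𝒪_{k̄}` is integrally closed in `k̄`; the torsion of `lim_{k′} H¹(G_{k′}, Ẑ(1))` is `κ(μ(k̄))`
[cite: NeukirchSchmidtWingberg2008, II §7]. Claim key `Mochizuki2012` (D-0012, DISPUTED); nothing here takes a side on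
[IUTchIII] Cor 3.12; typed ≠ proved ≠ endorsed.

PROVED: bookkeeping `mem_comap_nonzeroIntegers_of_pow_mem` / `mem_unitGroup_of_pow_mem` (root-closure of `𝒪^▷_{k̄}`,
`𝒪^×_{k̄}` inside `k̄ˣ`, any MLF-closure pair `k ⊆ K`), `EtaleThetaDataOfSetting.smul_mem_comap_nonzeroIntegers_padic` /
`smul_mem_unitGroup_padic` (`Π^tp_X̲̲`-stability through `ε`); at the genuine record with `O ⊇ μ` root-closed (resp. also
`Π`-stable): `EtaleLevels.hsat_thetaEnvRecordKummer_of_cyclotomeTower(_rigid)`,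
`EtaleLevels.hThetaU_thetaEnvRecordKummer_of_cyclotomeTower_rigid`; and for the two printed monoids
`…_nonzeroIntegers_…` (`O := 𝒪^▷_{ℚ̄_p}`), `…_unitGroup_…` (`O := 𝒪^×_{ℚ̄_p}`). Residual NAMED inputs of the `hsat` / `hΘU`
clauses at the genuine record after this file: abc-iut-w4-d030/d043's model data (`mods`/`hmods`/`h15`/`L`/`hZ`/`hcharY`), the
origin guard `IsEtThOrigin` (F-2498) and `IsCompact Δ_Θ` (GAP-LEDGER G-w5d187-1); for `hΘU` additionally the DATA of the
evaluation sections `s_t` into `Π^tp_Ÿ̲̲`, a class `θ ∈ θ^{i₀}_env(𝕄_*)` and print's root condition `hroots` on `∞θ^{i}_env`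
relative to `θ` (abc-iut-w4-d004 `hroots_toRecord` p427094 at `i = i₀` of a Prop 2.2 (ii)′ datum) — nothing else.
-/

noncomputable section

namespace Literature.IUT.HodgeArakelov

open Literature.AnabelianGeometry.EtaleTheta CohomologySystemOfContH1 EtaleThetaDataOfSetting
open Literature.AnabelianGeometry.AbsoluteAnabelian TemperedThetaMonoids

universe u

/-! ### Root-closure of print's constant monoids `𝒪^▷_{k̄}`, `𝒪^×_{k̄}` inside `k̄ˣ` (classical bookkeeping) -/

section RootClosed

variable {k : Type u} [Field k] [ValuativeRel k] {K : Type u} [Field K] [Algebra k K]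

/-- **`𝒪^▷_{k̄}` is root-closed in `k̄ˣ`**: if `a ∈ k̄ˣ` and `a ^ n ∈ 𝒪^▷_{k̄}` for some `0 < n`, then `a ∈ 𝒪^▷_{k̄}` — the ring
of integers (abc-iut-L4's `integersClosure k K = integralClosure 𝒪_k k̄`) is integrally closed in `k̄` (Mathlib
`IsIntegral.of_pow`). [cite: MochizukiAbsTopIII2015, Definition 3.1 (i) p.66] -/
theorem mem_comap_nonzeroIntegers_of_pow_mem {a : Kˣ} {n : ℕ} (hn : 0 < n)
    (h : a ^ n ∈ (nonzeroIntegers k K).comap (Units.coeHom K)) : a ∈ (nonzeroIntegers k K).comap (Units.coeHom K) := by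
  rw [Submonoid.mem_comap, map_pow] at h
  rw [Submonoid.mem_comap]
  have h1 : IsIntegral _ ((a : K) ^ n) := (mem_integralClosure_iff _ _).1 h.1
  exact ⟨(mem_integralClosure_iff _ _).2 (h1.of_pow hn), a.ne_zero⟩

/-- **`𝒪^×_{k̄}` is root-closed in `k̄ˣ`**: if `a ^ n ∈ 𝒪^×_{k̄}` (abc-iut-L4's `unitGroup k K`) for some `0 < n`, then
`a ∈ 𝒪^×_{k̄}` (both `a` and `a⁻¹` are integral, their `n`-th powers being so).
[cite: MochizukiAbsTopIII2015, Definition 3.1 (i) p.66] -/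
theorem mem_unitGroup_of_pow_mem {a : Kˣ} {n : ℕ} (hn : 0 < n) (h : a ^ n ∈ unitGroup k K) : a ∈ unitGroup k K := by
  have h' : a⁻¹ ^ n ∈ unitGroup k K := by
    rw [inv_pow]
    exact (unitGroup k K).inv_mem h
  rw [mem_unitGroup_iff, Units.val_pow_eq_pow_val] at h h'
  have ha : IsIntegral _ (a : K) := ((mem_integralClosure_iff _ _).1 h.1).of_pow hn
  have ha' : IsIntegral _ ((a⁻¹ : Kˣ) : K) := ((mem_integralClosure_iff _ _).1 h'.1).of_pow hn
  rw [mem_unitGroup_iff]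
  exact ⟨(mem_integralClosure_iff _ _).2 ha, ((a⁻¹ : Kˣ) : K), (mem_integralClosure_iff _ _).2 ha',
    by rw [← Units.val_mul, mul_inv_cancel, Units.val_one]⟩

end RootClosed

/-! ### `Π^tp_X̲̲`-stability of the two constant monoids through `ε` -/

namespace EtaleThetaDataOfSetting

variable {p : ℕ} [Fact p.Prime] {D : Literature.AnabelianGeometry.EtaleTheta.ThetaSetting p}
  {E : D.EtaleThetaData} {l : ℕ} (C : E.DoubleUnderline l)

/-- Print's constant monoid `𝒪^▷_{ℚ̄_p}` (pulled back to `ℚ̄_pˣ`) is stable under the Galois action of `Π^tp_X̲̲` through `ε`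
(abc-iut-L4 `smul_mem_nonzeroIntegers`). [cite: MochizukiAbsTopIII2015, Definition 3.1 (i) p.66] -/
theorem smul_mem_comap_nonzeroIntegers_padic (g : Pi C) {b : (PadicAlgCl p)ˣ}
    (hb : b ∈ (nonzeroIntegers ℚ_[p] (PadicAlgCl p)).comap (Units.coeHom (PadicAlgCl p))) :
    g • b ∈ (nonzeroIntegers ℚ_[p] (PadicAlgCl p)).comap (Units.coeHom (PadicAlgCl p)) := by
  rw [Submonoid.mem_comap] at hb ⊢
  exact smul_mem_nonzeroIntegers (aug C g) hb

/-- `𝒪^×_{ℚ̄_p}` (abc-iut-L4's `unitGroup`) is stable under the Galois action of `Π^tp_X̲̲` through `ε`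
(abc-iut-L4 `smul_mem_unitSubmonoid`). [cite: MochizukiAbsTopIII2015, Definition 3.1 (i) p.66] -/
theorem smul_mem_unitGroup_padic (g : Pi C) {b : (PadicAlgCl p)ˣ}
    (hb : b ∈ (unitGroup ℚ_[p] (PadicAlgCl p)).toSubmonoid) : g • b ∈ (unitGroup ℚ_[p] (PadicAlgCl p)).toSubmonoid := by
  rw [Subgroup.mem_toSubmonoid, mem_unitGroup_iff] at hb ⊢
  exact smul_mem_unitSubmonoid (aug C g) hb

end EtaleThetaDataOfSetting

/-! ### At the genuine record: `(c, hc)`, `hOtors`, `hlim` discharged; `hOroot`, `hO` for the printed monoids -/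

namespace EtaleLevels

variable {p : ℕ} [Fact p.Prime] {D : Literature.AnabelianGeometry.EtaleTheta.ThetaSetting p}
  {E : D.EtaleThetaData} {l : ℕ} (C : E.DoubleUnderline l) (hC : D.Compat) (hS : D.Sec2Hyps)
  (hl : l.Prime) (hp2 : p ≠ 2) (hpl : p ≠ l) (hζ : ∃ ζ : D.K, IsPrimitiveRoot ζ (4 * l))
  (mods : ∀ M : ℕ+, D.CyclotomeMod l M)
  (f : contCocycles D.toTheta D.DeltaTheta C.GtpYdduu) (hf : f ∈ C.rootCocycles hC)
  (hmods : ∀ (M M' : ℕ+) (h : (M : ℕ) ∣ (M' : ℕ)) (x : D.lDeltaTheta l),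
    MuN.red p M M' h ((mods M').red x) = (mods M).red x)
  (h15 : Literature.AnabelianGeometry.EtaleTheta.ThetaSetting.Prop15iii E hC) (L : C.CuspLabels)
  (hZ : ∀ M : ℕ+, Nonempty (ModelCyclotomes.lDeltaQuot (C.rigidData (mods M) hC hS h15 L) ≃*
    Literature.IUT.HodgeTheaters.ZHat))
  (hcharY : EtaleThetaDataOfSetting.PiYddCharacteristic C)
  (hlim : Function.Bijective (rigidLimHom C hC hS hl hp2 hpl hζ mods f hf hmods h15 L hZ))
  [(EtaleThetaDataOfSetting.PiYdd C).Normal]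
  (O : Submonoid (PadicAlgCl p)ˣ) (hOμ : ∀ a : (PadicAlgCl p)ˣ, IsOfFinOrder a → a ∈ O)
  (hOroot : ∀ (a : (PadicAlgCl p)ˣ) (n : ℕ), 0 < n → a ^ n ∈ O → a ∈ O) (ι₀ : Pi C)

omit [(EtaleThetaDataOfSetting.PiYdd C).Normal] in
include hmods in
/-- The coefficient datum from abc-iut-w4-d043's chain tower (abc-iut-w4-d007 `exists_cyclotomeCoefficients_of_cyclotomeTower`,
p422741): a BIJECTIVE change of coefficient cyclotome `c : Λ(ℚ̄_pˣ) ⥲ l·Δ_Θ` inverse to the model's own identifications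
`mods M` (`(mods M).red (c ζ) = ζ_M`), given the origin guard and compactness of `Δ_Θ`. (Bookkeeping step shared by the
theorems below; the same step as in abc-iut-w4-d007's `…GenuineRecordTorsionOfTower`.) [cite: Mochizuki2012, Cor 1.12 p.56] -/
theorem exists_cyclotomeCoefficients_mods (hO : D.IsEtThOrigin) (hΔ : IsCompact (D.DeltaTheta : Set D.GtpTheta)) :
    ∃ c : CyclotomeCoefficients (phi C) (D.lDeltaTheta l) (PadicAlgCl p)ˣ,
      Function.Bijective c.hom ∧
      ∀ (ζ : Literature.AnabelianGeometry.EtaleTheta.cyclotome (PadicAlgCl p)ˣ) (M : ℕ+),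
        (((mods M).red (c.hom ζ) : MuN p M) : (PadicAlgCl p)ˣ) = (ζ : ℕ+ → (PadicAlgCl p)ˣ) M := by
  obtain ⟨c, hc, hlev⟩ := exists_cyclotomeCoefficients_of_cyclotomeTower C hO hΔ
    (cyclotomeTower mods hmods (dvd_refl ((1 : ℕ+) : ℕ)))
  refine ⟨c, hc, fun ζ M => ?_⟩
  have hmod : ((cyclotomeTower mods hmods (dvd_refl ((1 : ℕ+) : ℕ))).modAll M).red (c.hom ζ) =
      (mods M).red (c.hom ζ) := by
    rw [ThetaSetting.CyclotomeTower.modAll_red, ThetaSetting.CyclotomeTower.redVia_apply]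
    exact hmods M _ _ (c.hom ζ)
  rw [← hmod]
  exact hlev ζ M

include hOμ hOroot in
/-- **`M^×_TM` SATURATED in the ambient module AT THE GENUINE RECORD, constants `ℚ̄_pˣ ⊇ O ⊇ μ` through `ε`, with `(c, hc)`
and `hOtors` DISCHARGED** (`O` root-closed kept BY NAME as `hOroot`): there is a bijective coefficient datum `c`, pinned by the
level formula, for which `x ^ n ∈ M^×_TM`, `0 < n` ⇒ `x ∈ M^×_TM` in `thetaEnvRecordKummer … c … O ι₀` (this seat's
`hsat_thetaEnvRecordKummer`, p428301). [claim: Mochizuki2012, status: disputed] (IUTchII §3 Cor 3.5 (ii), kurims p.95) -/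
theorem hsat_thetaEnvRecordKummer_of_cyclotomeTower (hO : D.IsEtThOrigin)
    (hΔ : IsCompact (D.DeltaTheta : Set D.GtpTheta)) :
    ∃ c : CyclotomeCoefficients (phi C) (D.lDeltaTheta l) (PadicAlgCl p)ˣ,
      Function.Bijective c.hom ∧
      (∀ (ζ : Literature.AnabelianGeometry.EtaleTheta.cyclotome (PadicAlgCl p)ˣ) (M : ℕ+),
        (((mods M).red (c.hom ζ) : MuN p M) : (PadicAlgCl p)ˣ) = (ζ : ℕ+ → (PadicAlgCl p)ˣ) M) ∧
      ∀ (x : (thetaEnvRecordKummer C hC hS hl hp2 hpl hζ mods f hf hmods h15 L hZ hcharY hlim c (isOpen_stabilizer_units C)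
          (finiteIndex_stabilizer_units C) O ι₀).H) (n : ℕ), 0 < n →
        x ^ n ∈ (thetaEnvRecordKummer C hC hS hl hp2 hpl hζ mods f hf hmods h15 L hZ hcharY hlim c (isOpen_stabilizer_units C)
          (finiteIndex_stabilizer_units C) O ι₀).units →
        x ∈ (thetaEnvRecordKummer C hC hS hl hp2 hpl hζ mods f hf hmods h15 L hZ hcharY hlim c (isOpen_stabilizer_units C)
          (finiteIndex_stabilizer_units C) O ι₀).units := by
  obtain ⟨c, hc, hlev⟩ := exists_cyclotomeCoefficients_mods C mods hmods hO hΔ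
  exact ⟨c, hc, hlev, hsat_thetaEnvRecordKummer C hC hS hl hp2 hpl hζ mods f hf hmods h15 L hZ hcharY hlim c
    (isOpen_stabilizer_units C) (finiteIndex_stabilizer_units C) O ι₀ hc (fun a ha => ⟨hOμ a ha, hOμ a⁻¹ ha.inv⟩) hOroot⟩

include hOμ hOroot in
/-- The same with the family binder `hlim` DISCHARGED by abc-iut-w4-d030's `bijective_rigidLimHom`.
[claim: Mochizuki2012, status: disputed] (IUTchII §3 Cor 3.5 (ii), kurims p.95) -/
theorem hsat_thetaEnvRecordKummer_of_cyclotomeTower_rigid (hO : D.IsEtThOrigin)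
    (hΔ : IsCompact (D.DeltaTheta : Set D.GtpTheta)) :
    ∃ c : CyclotomeCoefficients (phi C) (D.lDeltaTheta l) (PadicAlgCl p)ˣ,
      Function.Bijective c.hom ∧
      (∀ (ζ : Literature.AnabelianGeometry.EtaleTheta.cyclotome (PadicAlgCl p)ˣ) (M : ℕ+),
        (((mods M).red (c.hom ζ) : MuN p M) : (PadicAlgCl p)ˣ) = (ζ : ℕ+ → (PadicAlgCl p)ˣ) M) ∧
      ∀ (x : (thetaEnvRecordKummer C hC hS hl hp2 hpl hζ mods f hf hmods h15 L hZ hcharY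
          (bijective_rigidLimHom C hC hS hl hp2 hpl hζ mods f hf hmods h15 L hZ) c (isOpen_stabilizer_units C)
          (finiteIndex_stabilizer_units C) O ι₀).H) (n : ℕ), 0 < n →
        x ^ n ∈ (thetaEnvRecordKummer C hC hS hl hp2 hpl hζ mods f hf hmods h15 L hZ hcharY
          (bijective_rigidLimHom C hC hS hl hp2 hpl hζ mods f hf hmods h15 L hZ) c (isOpen_stabilizer_units C)
          (finiteIndex_stabilizer_units C) O ι₀).units →
        x ∈ (thetaEnvRecordKummer C hC hS hl hp2 hpl hζ mods f hf hmods h15 L hZ hcharY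
          (bijective_rigidLimHom C hC hS hl hp2 hpl hζ mods f hf hmods h15 L hZ) c (isOpen_stabilizer_units C)
          (finiteIndex_stabilizer_units C) O ι₀).units :=
  hsat_thetaEnvRecordKummer_of_cyclotomeTower C hC hS hl hp2 hpl hζ mods f hf hmods h15 L hZ hcharY
    (bijective_rigidLimHom C hC hS hl hp2 hpl hζ mods f hf hmods h15 L hZ) O hOμ hOroot ι₀ hO hΔ

include hOμ hOroot in
/-- **`hΘU` AT THE GENUINE RECORD, constants `ℚ̄_pˣ ⊇ O ⊇ μ` through `ε`, with `(c, hc)`, `hOtors`, `hlim` DISCHARGED**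
(`O` root-closed `hOroot` and `Π`-stable `hOst` kept BY NAME): there is a bijective coefficient datum `c`, pinned by the level
formula, such that in `thetaEnvRecordKummer … c … O ι₀`, for every family of evaluation sections `s_t : Π₀ → Π^tp_{X̲̲}` with
images in `Π^tp_{Ÿ̲̲}`, every `θ ∈ θ^{i₀'}_env(𝕄_*)` and every label `i` with print's root condition `hroots` on `∞θ^{i}_env`
relative to `θ`: `conj (s_t g) ϑ = u · ϑ` with `u ∈ M^×_TM` for all `g`, `t`, `ϑ ∈ ∞θ^{i}_env` (this seat's
`hThetaU_thetaEnvRecordKummer`, p428301). [claim: Mochizuki2012, status: disputed] (IUTchII §3 Cor 3.5 (ii), kurims p.95) -/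
theorem hThetaU_thetaEnvRecordKummer_of_cyclotomeTower_rigid
    (hOst : ∀ (σ : Pi C) (b : (PadicAlgCl p)ˣ), b ∈ O → σ • b ∈ O) (hO : D.IsEtThOrigin)
    (hΔ : IsCompact (D.DeltaTheta : Set D.GtpTheta)) {Lbl : Type} {P₀ : TopGroup.{0}} (s : Lbl → (P₀ →* Pi C))
    (hN : ∀ t, (⊤ : Subgroup P₀).map ((MonoidHom.id (Pi C)).comp (s t)) ≤ PiYdd C) :
    ∃ c : CyclotomeCoefficients (phi C) (D.lDeltaTheta l) (PadicAlgCl p)ˣ,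
      Function.Bijective c.hom ∧
      (∀ (ζ : Literature.AnabelianGeometry.EtaleTheta.cyclotome (PadicAlgCl p)ˣ) (M : ℕ+),
        (((mods M).red (c.hom ζ) : MuN p M) : (PadicAlgCl p)ˣ) = (ζ : ℕ+ → (PadicAlgCl p)ˣ) M) ∧
      ∀ {i₀' : Pi C}
        {θ : (thetaEnvRecordKummer C hC hS hl hp2 hpl hζ mods f hf hmods h15 L hZ hcharY
          (bijective_rigidLimHom C hC hS hl hp2 hpl hζ mods f hf hmods h15 L hZ) c (isOpen_stabilizer_units C)
          (finiteIndex_stabilizer_units C) O ι₀).H},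
        θ ∈ (thetaEnvRecordKummer C hC hS hl hp2 hpl hζ mods f hf hmods h15 L hZ hcharY
          (bijective_rigidLimHom C hC hS hl hp2 hpl hζ mods f hf hmods h15 L hZ) c (isOpen_stabilizer_units C)
          (finiteIndex_stabilizer_units C) O ι₀).thetaEnv i₀' →
        ∀ (i : (thetaEnvRecordKummer C hC hS hl hp2 hpl hζ mods f hf hmods h15 L hZ hcharY
          (bijective_rigidLimHom C hC hS hl hp2 hpl hζ mods f hf hmods h15 L hZ) c (isOpen_stabilizer_units C)
          (finiteIndex_stabilizer_units C) O ι₀).Iota),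
        (∀ ϑ ∈ (thetaEnvRecordKummer C hC hS hl hp2 hpl hζ mods f hf hmods h15 L hZ hcharY
            (bijective_rigidLimHom C hC hS hl hp2 hpl hζ mods f hf hmods h15 L hZ) c (isOpen_stabilizer_units C)
            (finiteIndex_stabilizer_units C) O ι₀).inftyThetaEnv i,
          ∃ n : ℕ, 0 < n ∧ ϑ ^ n ∈
            splitMonoid (thetaEnvRecordKummer C hC hS hl hp2 hpl hζ mods f hf hmods h15 L hZ hcharY
              (bijective_rigidLimHom C hC hS hl hp2 hpl hζ mods f hf hmods h15 L hZ) c (isOpen_stabilizer_units C)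
              (finiteIndex_stabilizer_units C) O ι₀).units (Submonoid.powers θ)) →
        ∀ (g : P₀) (t : Lbl),
          ∀ ϑ ∈ (thetaEnvRecordKummer C hC hS hl hp2 hpl hζ mods f hf hmods h15 L hZ hcharY
              (bijective_rigidLimHom C hC hS hl hp2 hpl hζ mods f hf hmods h15 L hZ) c (isOpen_stabilizer_units C)
              (finiteIndex_stabilizer_units C) O ι₀).inftyThetaEnv i,
            ∃ u ∈ (thetaEnvRecordKummer C hC hS hl hp2 hpl hζ mods f hf hmods h15 L hZ hcharY
                (bijective_rigidLimHom C hC hS hl hp2 hpl hζ mods f hf hmods h15 L hZ) c (isOpen_stabilizer_units C)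
                (finiteIndex_stabilizer_units C) O ι₀).units,
              (thetaEnvRecordKummer C hC hS hl hp2 hpl hζ mods f hf hmods h15 L hZ hcharY
                (bijective_rigidLimHom C hC hS hl hp2 hpl hζ mods f hf hmods h15 L hZ) c (isOpen_stabilizer_units C)
                (finiteIndex_stabilizer_units C) O ι₀).conj (s t g) ϑ = u * ϑ := by
  obtain ⟨c, hc, hlev⟩ := exists_cyclotomeCoefficients_mods C mods hmods hO hΔ
  refine ⟨c, hc, hlev, fun {i₀'} {θ} hθ i hroots => ?_⟩
  exact hThetaU_thetaEnvRecordKummer C hC hS hl hp2 hpl hζ mods f hf hmods h15 L hZ hcharY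
    (bijective_rigidLimHom C hC hS hl hp2 hpl hζ mods f hf hmods h15 L hZ) c (isOpen_stabilizer_units C)
    (finiteIndex_stabilizer_units C) O hOst ι₀ hc (fun a ha => ⟨hOμ a ha, hOμ a⁻¹ ha.inv⟩) hOroot s hN hθ i hroots

/-! #### The two printed constant monoids: `hOμ`, `hOroot`, `hOst` discharged -/

/-- Every root of unity of `ℚ̄_pˣ` lies in print's constant monoid `𝒪^▷_{ℚ̄_p}` (pulled back to `ℚ̄_pˣ`) — a unit of the ring of
integers (abc-iut-w5-d205 `mem_unitGroup_padic_of_isOfFinOrder`) is a non-zero integer (abc-iut-L4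
`unitSubmonoid_le_nonzeroIntegers`); same statement as abc-iut-w4-d007's `mem_comap_nonzeroIntegers_padic_of_isOfFinOrder`,
re-derived in two lines (that file's olean was not yet available to import). [cite: MochizukiAbsTopIII2015, Definition 3.1 (i) p.66] -/
theorem mem_comap_nonzeroIntegers_padic_of_isOfFinOrder' {u : (PadicAlgCl p)ˣ} (hu : IsOfFinOrder u) :
    u ∈ (nonzeroIntegers ℚ_[p] (PadicAlgCl p)).comap (Units.coeHom (PadicAlgCl p)) :=
  Submonoid.mem_comap.mpr (unitSubmonoid_le_nonzeroIntegers ((mem_unitGroup_iff u).mp (mem_unitGroup_padic_of_isOfFinOrder hu)))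

/-- **`O := 𝒪^▷_{ℚ̄_p}`, PRINT'S CONSTANT MONOID** ("`Ψ_cns … ≅ O^▷_{F̄_v}`", Prop 3.1 (ii) p. 88): `M^×_TM` saturated in the
ambient module at the genuine record, `(c, hc)` / `hOtors` / `hOroot` / `hlim` ALL discharged.
[claim: Mochizuki2012, status: disputed] (IUTchII §3 Cor 3.5 (ii), kurims p.95) -/
theorem hsat_thetaEnvRecordKummer_nonzeroIntegers_of_cyclotomeTower_rigid (hO : D.IsEtThOrigin)
    (hΔ : IsCompact (D.DeltaTheta : Set D.GtpTheta)) :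
    ∃ c : CyclotomeCoefficients (phi C) (D.lDeltaTheta l) (PadicAlgCl p)ˣ,
      Function.Bijective c.hom ∧
      (∀ (ζ : Literature.AnabelianGeometry.EtaleTheta.cyclotome (PadicAlgCl p)ˣ) (M : ℕ+),
        (((mods M).red (c.hom ζ) : MuN p M) : (PadicAlgCl p)ˣ) = (ζ : ℕ+ → (PadicAlgCl p)ˣ) M) ∧
      ∀ (x : (thetaEnvRecordKummer C hC hS hl hp2 hpl hζ mods f hf hmods h15 L hZ hcharY
          (bijective_rigidLimHom C hC hS hl hp2 hpl hζ mods f hf hmods h15 L hZ) c (isOpen_stabilizer_units C)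
          (finiteIndex_stabilizer_units C) ((nonzeroIntegers ℚ_[p] (PadicAlgCl p)).comap (Units.coeHom (PadicAlgCl p)))
          ι₀).H) (n : ℕ), 0 < n →
        x ^ n ∈ (thetaEnvRecordKummer C hC hS hl hp2 hpl hζ mods f hf hmods h15 L hZ hcharY
          (bijective_rigidLimHom C hC hS hl hp2 hpl hζ mods f hf hmods h15 L hZ) c (isOpen_stabilizer_units C)
          (finiteIndex_stabilizer_units C) ((nonzeroIntegers ℚ_[p] (PadicAlgCl p)).comap (Units.coeHom (PadicAlgCl p)))
          ι₀).units →
        x ∈ (thetaEnvRecordKummer C hC hS hl hp2 hpl hζ mods f hf hmods h15 L hZ hcharY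
          (bijective_rigidLimHom C hC hS hl hp2 hpl hζ mods f hf hmods h15 L hZ) c (isOpen_stabilizer_units C)
          (finiteIndex_stabilizer_units C) ((nonzeroIntegers ℚ_[p] (PadicAlgCl p)).comap (Units.coeHom (PadicAlgCl p)))
          ι₀).units :=
  hsat_thetaEnvRecordKummer_of_cyclotomeTower_rigid C hC hS hl hp2 hpl hζ mods f hf hmods h15 L hZ hcharY
    ((nonzeroIntegers ℚ_[p] (PadicAlgCl p)).comap (Units.coeHom (PadicAlgCl p)))
    (fun _ ha => mem_comap_nonzeroIntegers_padic_of_isOfFinOrder' ha)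
    (fun _ _ hn ha => mem_comap_nonzeroIntegers_of_pow_mem hn ha) ι₀ hO hΔ

/-- **`O := 𝒪^×_{ℚ̄_p}`** (abc-iut-L4's `unitGroup ℚ_[p] ℚ̄_p`, [AbsTopIII] Def 3.1 (i)): `M^×_TM` saturated in the ambient
module at the genuine record, `(c, hc)` / `hOtors` / `hOroot` / `hlim` ALL discharged.
[claim: Mochizuki2012, status: disputed] (IUTchII §3 Cor 3.5 (ii), kurims p.95) -/
theorem hsat_thetaEnvRecordKummer_unitGroup_of_cyclotomeTower_rigid (hO : D.IsEtThOrigin)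
    (hΔ : IsCompact (D.DeltaTheta : Set D.GtpTheta)) :
    ∃ c : CyclotomeCoefficients (phi C) (D.lDeltaTheta l) (PadicAlgCl p)ˣ,
      Function.Bijective c.hom ∧
      (∀ (ζ : Literature.AnabelianGeometry.EtaleTheta.cyclotome (PadicAlgCl p)ˣ) (M : ℕ+),
        (((mods M).red (c.hom ζ) : MuN p M) : (PadicAlgCl p)ˣ) = (ζ : ℕ+ → (PadicAlgCl p)ˣ) M) ∧
      ∀ (x : (thetaEnvRecordKummer C hC hS hl hp2 hpl hζ mods f hf hmods h15 L hZ hcharY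
          (bijective_rigidLimHom C hC hS hl hp2 hpl hζ mods f hf hmods h15 L hZ) c (isOpen_stabilizer_units C)
          (finiteIndex_stabilizer_units C) (unitGroup ℚ_[p] (PadicAlgCl p)).toSubmonoid ι₀).H) (n : ℕ), 0 < n →
        x ^ n ∈ (thetaEnvRecordKummer C hC hS hl hp2 hpl hζ mods f hf hmods h15 L hZ hcharY
          (bijective_rigidLimHom C hC hS hl hp2 hpl hζ mods f hf hmods h15 L hZ) c (isOpen_stabilizer_units C)
          (finiteIndex_stabilizer_units C) (unitGroup ℚ_[p] (PadicAlgCl p)).toSubmonoid ι₀).units →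
        x ∈ (thetaEnvRecordKummer C hC hS hl hp2 hpl hζ mods f hf hmods h15 L hZ hcharY
          (bijective_rigidLimHom C hC hS hl hp2 hpl hζ mods f hf hmods h15 L hZ) c (isOpen_stabilizer_units C)
          (finiteIndex_stabilizer_units C) (unitGroup ℚ_[p] (PadicAlgCl p)).toSubmonoid ι₀).units :=
  hsat_thetaEnvRecordKummer_of_cyclotomeTower_rigid C hC hS hl hp2 hpl hζ mods f hf hmods h15 L hZ hcharY
    (unitGroup ℚ_[p] (PadicAlgCl p)).toSubmonoid (fun _ ha => mem_unitGroup_padic_of_isOfFinOrder ha)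
    (fun _ _ hn ha => mem_unitGroup_of_pow_mem hn ha) ι₀ hO hΔ

/-- **`hΘU` for `O := 𝒪^▷_{ℚ̄_p}`, PRINT'S CONSTANT MONOID, AT THE GENUINE RECORD with `(c, hc)`, `hOtors`, `hOroot`, `hO`
(`Π`-stability) and `hlim` ALL DISCHARGED**: for every family of evaluation sections `s_t : Π₀ → Π^tp_{X̲̲}` with images in
`Π^tp_{Ÿ̲̲}`, there is a bijective coefficient datum `c`, pinned by the level formula, such that for every
`θ ∈ θ^{i₀'}_env(𝕄_*)`, every label `i` with print's root condition `hroots` on `∞θ^{i}_env` relative to `θ`, and all `g`, `t`,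
`ϑ ∈ ∞θ^{i}_env`: `conj (s_t g) ϑ = u · ϑ` with `u ∈ M^×_TM`. Residual inputs: model data, `IsEtThOrigin`, `IsCompact Δ_Θ`,
the sections, `θ`, `hroots`. [claim: Mochizuki2012, status: disputed] (IUTchII §3 Cor 3.5 (ii), kurims p.95) -/
theorem hThetaU_thetaEnvRecordKummer_nonzeroIntegers_of_cyclotomeTower_rigid (hO : D.IsEtThOrigin)
    (hΔ : IsCompact (D.DeltaTheta : Set D.GtpTheta)) {Lbl : Type} {P₀ : TopGroup.{0}} (s : Lbl → (P₀ →* Pi C))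
    (hN : ∀ t, (⊤ : Subgroup P₀).map ((MonoidHom.id (Pi C)).comp (s t)) ≤ PiYdd C) :
    ∃ c : CyclotomeCoefficients (phi C) (D.lDeltaTheta l) (PadicAlgCl p)ˣ,
      Function.Bijective c.hom ∧
      (∀ (ζ : Literature.AnabelianGeometry.EtaleTheta.cyclotome (PadicAlgCl p)ˣ) (M : ℕ+),
        (((mods M).red (c.hom ζ) : MuN p M) : (PadicAlgCl p)ˣ) = (ζ : ℕ+ → (PadicAlgCl p)ˣ) M) ∧
      ∀ {i₀' : Pi C}
        {θ : (thetaEnvRecordKummer C hC hS hl hp2 hpl hζ mods f hf hmods h15 L hZ hcharY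
          (bijective_rigidLimHom C hC hS hl hp2 hpl hζ mods f hf hmods h15 L hZ) c (isOpen_stabilizer_units C)
          (finiteIndex_stabilizer_units C) ((nonzeroIntegers ℚ_[p] (PadicAlgCl p)).comap (Units.coeHom (PadicAlgCl p)))
          ι₀).H},
        θ ∈ (thetaEnvRecordKummer C hC hS hl hp2 hpl hζ mods f hf hmods h15 L hZ hcharY
          (bijective_rigidLimHom C hC hS hl hp2 hpl hζ mods f hf hmods h15 L hZ) c (isOpen_stabilizer_units C)
          (finiteIndex_stabilizer_units C) ((nonzeroIntegers ℚ_[p] (PadicAlgCl p)).comap (Units.coeHom (PadicAlgCl p)))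
          ι₀).thetaEnv i₀' →
        ∀ (i : (thetaEnvRecordKummer C hC hS hl hp2 hpl hζ mods f hf hmods h15 L hZ hcharY
          (bijective_rigidLimHom C hC hS hl hp2 hpl hζ mods f hf hmods h15 L hZ) c (isOpen_stabilizer_units C)
          (finiteIndex_stabilizer_units C) ((nonzeroIntegers ℚ_[p] (PadicAlgCl p)).comap (Units.coeHom (PadicAlgCl p)))
          ι₀).Iota),
        (∀ ϑ ∈ (thetaEnvRecordKummer C hC hS hl hp2 hpl hζ mods f hf hmods h15 L hZ hcharY
            (bijective_rigidLimHom C hC hS hl hp2 hpl hζ mods f hf hmods h15 L hZ) c (isOpen_stabilizer_units C)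
            (finiteIndex_stabilizer_units C) ((nonzeroIntegers ℚ_[p] (PadicAlgCl p)).comap (Units.coeHom (PadicAlgCl p)))
            ι₀).inftyThetaEnv i,
          ∃ n : ℕ, 0 < n ∧ ϑ ^ n ∈
            splitMonoid (thetaEnvRecordKummer C hC hS hl hp2 hpl hζ mods f hf hmods h15 L hZ hcharY
              (bijective_rigidLimHom C hC hS hl hp2 hpl hζ mods f hf hmods h15 L hZ) c (isOpen_stabilizer_units C)
              (finiteIndex_stabilizer_units C) ((nonzeroIntegers ℚ_[p] (PadicAlgCl p)).comap (Units.coeHom (PadicAlgCl p)))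
              ι₀).units (Submonoid.powers θ)) →
        ∀ (g : P₀) (t : Lbl),
          ∀ ϑ ∈ (thetaEnvRecordKummer C hC hS hl hp2 hpl hζ mods f hf hmods h15 L hZ hcharY
              (bijective_rigidLimHom C hC hS hl hp2 hpl hζ mods f hf hmods h15 L hZ) c (isOpen_stabilizer_units C)
              (finiteIndex_stabilizer_units C) ((nonzeroIntegers ℚ_[p] (PadicAlgCl p)).comap (Units.coeHom (PadicAlgCl p)))
              ι₀).inftyThetaEnv i,
            ∃ u ∈ (thetaEnvRecordKummer C hC hS hl hp2 hpl hζ mods f hf hmods h15 L hZ hcharY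
                (bijective_rigidLimHom C hC hS hl hp2 hpl hζ mods f hf hmods h15 L hZ) c (isOpen_stabilizer_units C)
                (finiteIndex_stabilizer_units C) ((nonzeroIntegers ℚ_[p] (PadicAlgCl p)).comap (Units.coeHom (PadicAlgCl p)))
                ι₀).units,
              (thetaEnvRecordKummer C hC hS hl hp2 hpl hζ mods f hf hmods h15 L hZ hcharY
                (bijective_rigidLimHom C hC hS hl hp2 hpl hζ mods f hf hmods h15 L hZ) c (isOpen_stabilizer_units C)
                (finiteIndex_stabilizer_units C) ((nonzeroIntegers ℚ_[p] (PadicAlgCl p)).comap (Units.coeHom (PadicAlgCl p)))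
                ι₀).conj (s t g) ϑ = u * ϑ :=
  hThetaU_thetaEnvRecordKummer_of_cyclotomeTower_rigid C hC hS hl hp2 hpl hζ mods f hf hmods h15 L hZ hcharY
    ((nonzeroIntegers ℚ_[p] (PadicAlgCl p)).comap (Units.coeHom (PadicAlgCl p)))
    (fun _ ha => mem_comap_nonzeroIntegers_padic_of_isOfFinOrder' ha)
    (fun _ _ hn ha => mem_comap_nonzeroIntegers_of_pow_mem hn ha) ι₀
    (fun σ _ hb => EtaleThetaDataOfSetting.smul_mem_comap_nonzeroIntegers_padic C σ hb) hO hΔ s hN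

end EtaleLevels

end Literature.IUT.HodgeArakelov

end
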